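import Summits.HodgeConjecture.HodgeConjecture.Theorems.K2LiuDoubledKernelUndoubling
import Literature.NumberTheory.K2Lit.DoublingEmbedding
import HarnessLib

/-!
# D8's doubled line-theta kernel at the doubling embedding `ι(g₁, g₂)`: the two slots as explicit elements of `U(diag(dD ∘ castAdd))(𝔸)`,
# `U(diag(dD ∘ natAdd))(𝔸)` — organ (O44d″) of socket #44∕45R (Step 2 of the assembly, `K2/K2Liu-p03/g3/ROAD-44-45R-Assembly`)

Track B ∕ hLiu418 = stmt-HodgeConjecture-24832, line `K2_Liu_CurveThetaSigs`, unit U6 ED. 6, socket #44∕45R `sig_K2LiuUndoublingSeparation`;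
seat `hodgecm-mathlib-K2Liu-p03` (g3).  ★ `K2LiuDoubledKernelUndoubling.lineThetaKer_dD_blockDiag` undoubles the kernel at any `h ∈ U(diag dD)(𝔸)`
with `GL`-matrix `reindex e₂ (diag(k₁, k₂))`; the hypothesis of #44∕45R reads it at `h = (toDiagA ι(g₁, g₂))⁻¹` (★ `K2Lit/DoublingEmbedding.iotaV`,
★ `K2Lit/DoubledLineThetaKernel.toDiagA`), whose blocks are `reindex e (gⱼ⁻¹ ⊗ 1)` (★ `coe_iotaGG`, ★ `coe_toDiagA`).  This file supplies:

* §1 `reindex_kronecker_adelicForm_diagonal` — `reindex e e (diag dV ⊗ 1 ⊗ₖ diag dW ⊗ 1) = diag (dD ∘ castAdd) ⊗ 1` (the undoubled Gram of D8's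
  first block IS the slot frame), and the memberships `reindexGL_adelicInl_mem_castAdd ∕ _natAdd`: `reindex e (g ⊗ 1) ∈ U(diag(dD ∘ castAdd))(𝔸)` and
  `∈ U(diag(dD ∘ natAdd))(𝔸) = U(−diag(dD ∘ castAdd))(𝔸)` for `g ∈ U(diag dV)(𝔸)`;
* §2 **`lineThetaKer_dD_iotaV`** — `θ^{dD}_{Φ₁ ⊠_ι Φ₂}(mk (toDiagA ι(g₁,g₂))⁻¹, mk u) = θ^{dD∘castAdd}_{Φ₁}(mk k₁(g₁)⁻¹, mk u) · θ^{dD∘natAdd}_{Φ₂}(mk k₂(g₂)⁻¹, mk u)`,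
  `kⱼ(g) := ⟨reindex e (g ⊗ 1), §1⟩` — the shape in which the socket's hypothesis kernel `θ(mk (ιA y)⁻¹, q)` is written.

No definition, no instance, no named fact, no `sorry`; axioms ⊆ {propext, Classical.choice, Quot.sound}.

## References
* [HarrisKudlaSweet1996] M. Harris, S. Kudla, W. J. Sweet, J. AMS 9 (1996), §1 (1.8)–(1.11), Lem. 1.1 p. 953.
* [Liu2021] Y. Liu, Camb. J. Math. 9 (2021), App. B (B.7), §B.3 p. 101 (`ı : G × G → G^◇`).
* [Kudla1994] S. Kudla, Israel J. Math. 87 (1994), §2, §3 Thm. 3.1.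

HONEST LABEL: HC_CM is proved only modulo the 7 printed citations (2 remaining named inputs: hLiu418 = stmt-HodgeConjecture-24832, h413 =
stmt-HodgeConjecture-24833) until rung 0 closes; this helper moves no counter.
-/

set_option autoImplicit false

set_option linter.dupNamespace false

noncomputable section

open scoped Classical
open scoped Matrix Kronecker
open NumberField IsDedekindDomain
open Literature.RepresentationTheory.HeisenbergGroup
open Literature.NumberTheory.Automorphic
open Literature.NumberTheory.Weil1964
open Literature.RepresentationTheory.HarrisKudlaSweet1996
open Literature.NumberTheory.GaloisRepresentations

namespace Summit.HodgeConjecture.HodgeConjecture.Cruxes.HLiu418.K2LiuDoubledKernelAtIota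

open Literature.NumberTheory.Automorphic.UnitaryGroup
open Literature.NumberTheory.Automorphic.IdeleClassGroup
open Literature.NumberTheory.GelbartRogawski1991 Literature.NumberTheory.GelbartRogawski1991.UnitaryDualPair
open Literature.NumberTheory.GelbartRogawski1991.GRConstruction
open Literature.NumberTheory.Automorphic.Liu2021 Literature.NumberTheory.Automorphic.Liu2021.Def411WeilCarriers
open Literature.NumberTheory.Automorphic.Liu2021.Def411WeilCarriersDoubling
open Literature.NumberTheory.K2Lit.DoubledLineTheta Literature.NumberTheory.K2Lit.SiegelDoubled
open Literature.RepresentationTheory.Liu2021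
open Summit.HodgeConjecture.HodgeConjecture.Cruxes.HLiu418.K2LiuDoubledKernelUndoubling

variable (L : Type) [Field L] [NumberField L] [IsCMField L]
variable {N M n : ℕ} (e : Fin N × Fin M ≃ Fin n)
  (dV : Fin N → L) (hdV : ∀ i, IsCMField.complexConj L (dV i) = dV i) (hdV0 : ∀ i, dV i ≠ 0)
  (dW : Fin M → L) (hdW : ∀ i, IsCMField.complexConj L (dW i) = dW i) (hdW0 : ∀ i, dW i ≠ 0)

/-! ## §1 The slot frames and the block elements -/

/-- **`reindex e e ((diag dV ⊗ 1) ⊗ₖ (diag dW ⊗ 1)) = diag (dD ∘ castAdd) ⊗ 1`**: the reindexed Kronecker form of the pair `(V, W)` is the adelic form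
of D8's first slot frame (`dD (castAdd k) = t₀ k = dV (e⁻¹k)₁ · dW (e⁻¹k)₂`). [cite: HarrisKudlaSweet1996, §1 (1.9)] -/
theorem reindex_kronecker_adelicForm_diagonal :
    Matrix.reindex e e (UnitaryGroup.adelicForm L N (Matrix.diagonal dV) ⊗ₖ UnitaryGroup.adelicForm L M (Matrix.diagonal dW)) =
      UnitaryGroup.adelicForm L n (Matrix.diagonal fun i => dD L e dV hdV dW hdW (Fin.castAdd n i)) := by
  unfold UnitaryGroup.adelicForm
  rw [Matrix.diagonal_map (map_zero _), Matrix.diagonal_map (map_zero _), Matrix.diagonal_kronecker_diagonal, Matrix.reindex_apply,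
    Matrix.submatrix_diagonal_equiv, Matrix.diagonal_map (map_zero _)]
  refine congrArg Matrix.diagonal (funext fun k => ?_)
  simp only [Function.comp_apply, dD, finSumFinEquiv_symm_apply_castAdd, Sum.elim_inl, coe_cmGramEntry, map_mul]

/-- the second slot frame is the NEGATIVE of the first: `diag (dD ∘ natAdd) ⊗ 1 = −(diag (dD ∘ castAdd) ⊗ 1)`.
[cite: HarrisKudlaSweet1996, §1 (1.9)] -/
theorem adelicForm_diagonal_natAdd :
    UnitaryGroup.adelicForm L n (Matrix.diagonal fun i => dD L e dV hdV dW hdW (Fin.natAdd n i)) =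
      -UnitaryGroup.adelicForm L n (Matrix.diagonal fun i => dD L e dV hdV dW hdW (Fin.castAdd n i)) := by
  unfold UnitaryGroup.adelicForm
  rw [Matrix.diagonal_map (map_zero _), Matrix.diagonal_map (map_zero _)]
  refine (congrArg Matrix.diagonal (funext fun k => ?_)).trans (Matrix.diagonal_neg _).symm
  simp only [dD, finSumFinEquiv_symm_apply_castAdd, finSumFinEquiv_symm_apply_natAdd, Sum.elim_inl, Sum.elim_inr,
    Pi.neg_apply, NegMemClass.coe_neg, map_neg]

/-- **`reindex e (g ⊗ 1) ∈ U(diag(dD ∘ castAdd))(𝔸)`** for `g ∈ U(diag dV)(𝔸)` (★ `reindexGL_mem_iff` + §1). [cite: Liu2021, §B.3 p. 101] -/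
theorem reindexGL_adelicInl_mem_castAdd (g : UnitaryGroup.adelic (Fp L) L (IsCMField.complexConj L) N (Matrix.diagonal dV)) :
    UnitaryGroup.reindexGL e
        ((UnitaryGroup.adelicInl (Fp L) L (IsCMField.complexConj L) N M (Matrix.diagonal dV) (Matrix.diagonal dW) g :
          UnitaryGroup.adelicPair (Fp L) L (IsCMField.complexConj L) N M (Matrix.diagonal dV) (Matrix.diagonal dW)) :
            GL (Fin N × Fin M) (AdeleRing (𝓞 L) L)) ∈
      UnitaryGroup.adelic (Fp L) L (IsCMField.complexConj L) n (Matrix.diagonal fun i => dD L e dV hdV dW hdW (Fin.castAdd n i)) := by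
  have h := (UnitaryGroup.reindexGL_mem_iff (UnitaryGroup.conjAdele (Fp L) L (IsCMField.complexConj L)) e
    (UnitaryGroup.adelicForm L N (Matrix.diagonal dV) ⊗ₖ UnitaryGroup.adelicForm L M (Matrix.diagonal dW)) _).2
    (UnitaryGroup.adelicInl (Fp L) L (IsCMField.complexConj L) N M (Matrix.diagonal dV) (Matrix.diagonal dW) g).2
  rw [reindex_kronecker_adelicForm_diagonal] at h
  exact h

/-- **`reindex e (g ⊗ 1) ∈ U(diag(dD ∘ natAdd))(𝔸)`** (`= U(−diag(dD ∘ castAdd) ⊗ 1)`, same matrix group, ★ `unitaryGroupOfForm_neg'`).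
[cite: Liu2021, §B.3 p. 101] [cite: Kudla1994, §2 (doubled space, Siegel parabolic)] -/
theorem reindexGL_adelicInl_mem_natAdd (g : UnitaryGroup.adelic (Fp L) L (IsCMField.complexConj L) N (Matrix.diagonal dV)) :
    UnitaryGroup.reindexGL e
        ((UnitaryGroup.adelicInl (Fp L) L (IsCMField.complexConj L) N M (Matrix.diagonal dV) (Matrix.diagonal dW) g :
          UnitaryGroup.adelicPair (Fp L) L (IsCMField.complexConj L) N M (Matrix.diagonal dV) (Matrix.diagonal dW)) :
            GL (Fin N × Fin M) (AdeleRing (𝓞 L) L)) ∈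
      UnitaryGroup.adelic (Fp L) L (IsCMField.complexConj L) n (Matrix.diagonal fun i => dD L e dV hdV dW hdW (Fin.natAdd n i)) := by
  have h := reindexGL_adelicInl_mem_castAdd L e dV hdV dW hdW g
  unfold UnitaryGroup.adelic at h ⊢
  rw [adelicForm_diagonal_natAdd, unitaryGroupOfForm_neg']
  exact h

/-! ## §2 The kernel at `ι(g₁, g₂)` -/

variable {n'' n₁ n₂ : ℕ} (eD : Fin (n + n) × Fin 1 ≃ Fin n'') (eA : Fin n × Fin 1 ≃ Fin n₁) (eB : Fin n × Fin 1 ≃ Fin n₂)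
  (μ : Literature.NumberTheory.Automorphic.IdeleClassGroup L →ₜ* Circle) (hμ : IsConjugateSymplectic L μ) (a : (Fp L)ˣ)

/-- the `GL`-matrix of `toDiagA ι(g₁, g₂)`: `reindex e₂ (diag(reindex e (g₁ ⊗ 1), reindex e (g₂ ⊗ 1)))` (★ `coe_toDiagA`, ★ `coe_iotaGG`).
[cite: Liu2021, §B.3 p. 101] -/
theorem coe_toDiagA_iotaV (g₁ g₂ : UnitaryGroup.adelic (Fp L) L (IsCMField.complexConj L) N (Matrix.diagonal dV)) :
    ((toDiagA L e dV hdV dW hdW (iotaV L e dV hdV dW hdW (g₁, g₂)) :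
        UnitaryGroup.adelic (Fp L) L (IsCMField.complexConj L) (n + n) (Matrix.diagonal (dD L e dV hdV dW hdW))) :
          GL (Fin (n + n)) (AdeleRing (𝓞 L) L)) =
      UnitaryGroup.reindexGL (GRConstruction.e₂ (n := n))
        (UnitaryGroup.blockDiagGL
          (((⟨_, reindexGL_adelicInl_mem_castAdd L e dV hdV dW hdW g₁⟩ :
              UnitaryGroup.adelic (Fp L) L (IsCMField.complexConj L) n (Matrix.diagonal fun i => dD L e dV hdV dW hdW (Fin.castAdd n i))) :
                GL (Fin n) (AdeleRing (𝓞 L) L)),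
            ((⟨_, reindexGL_adelicInl_mem_natAdd L e dV hdV dW hdW g₂⟩ :
              UnitaryGroup.adelic (Fp L) L (IsCMField.complexConj L) n (Matrix.diagonal fun i => dD L e dV hdV dW hdW (Fin.natAdd n i))) :
                GL (Fin n) (AdeleRing (𝓞 L) L)))) := by
  rw [coe_toDiagA]
  rfl

/-- **D8's DOUBLED KERNEL AT `ι(g₁, g₂)`, UNDOUBLED**: for `g₁, g₂ ∈ U(diag dV)(𝔸)`, `u ∈ U(⟨a⟩)(𝔸)`,
`θ^{dD}_{Φ₁ ⊠_ι Φ₂}(mk (toDiagA ι(g₁,g₂))⁻¹, mk u) = θ^{dD∘castAdd}_{Φ₁}(mk k₁(g₁)⁻¹, mk u) · θ^{dD∘natAdd}_{Φ₂}(mk k₂(g₂)⁻¹, mk u)` with `kⱼ(g) = reindex e (g ⊗ 1)` read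
in the slot group (★ `lineThetaKer_dD_blockDiag` at `h := toDiagA ι(g₁⁻¹, g₂⁻¹)`). [cite: HarrisKudlaSweet1996, §1 Lem. 1.1 p. 953, (1.8)–(1.11)]
[cite: Liu2021, App. B (B.7), §B.3 p. 101] [cite: Kudla1994, §3 Thm. 3.1] -/
theorem lineThetaKer_dD_iotaV
    (hρD : HasThetaMajorants fun
      (p : ↥(UnitaryGroup.adelic (Fp L) L (IsCMField.complexConj L) (n + n) (Matrix.diagonal (dD L e dV hdV dW hdW))) ×
        ↥(UnitaryGroup.adelic (Fp L) L (IsCMField.complexConj L) 1 (JW (Fp L) L a)))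
      (Φ : piSchwartzBruhat (Fp L) (Fin n'')) =>
        pairRep (Fp L) L (IsCMField.complexConj L) (n + n) 1 eD (Matrix.diagonal (dD L e dV hdV dW hdW)) (JW (Fp L) L a)
          (chiSplittingLine L eD (dD L e dV hdV dW hdW) (dD_conj L e dV hdV dW hdW) (dD_ne_zero L e dV hdV dW hdW hdV0 hdW0)
            (toHeckeCharacter L μ) (isUnitary_toHeckeCharacter L μ)
            ((isOscillatorChar_toHeckeCharacter_iff μ).mpr hμ) (TW (Fp L) a)
            (isUnit_det_TW (Fp L) a) (JW (Fp L) L a) (JW_eq (Fp L) L a))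
          p Φ)
    (hρA : HasThetaMajorants fun
      (p : ↥(UnitaryGroup.adelic (Fp L) L (IsCMField.complexConj L) n (Matrix.diagonal fun i => dD L e dV hdV dW hdW (Fin.castAdd n i))) ×
        ↥(UnitaryGroup.adelic (Fp L) L (IsCMField.complexConj L) 1 (JW (Fp L) L a)))
      (Φ : piSchwartzBruhat (Fp L) (Fin n₁)) =>
        pairRep (Fp L) L (IsCMField.complexConj L) n 1 eA (Matrix.diagonal fun i => dD L e dV hdV dW hdW (Fin.castAdd n i)) (JW (Fp L) L a)
          (chiSplittingLine L eA (fun i => dD L e dV hdV dW hdW (Fin.castAdd n i)) (fun i => dD_conj L e dV hdV dW hdW (Fin.castAdd n i))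
            (fun i => dD_ne_zero L e dV hdV dW hdW hdV0 hdW0 (Fin.castAdd n i))
            (toHeckeCharacter L μ) (isUnitary_toHeckeCharacter L μ)
            ((isOscillatorChar_toHeckeCharacter_iff μ).mpr hμ) (TW (Fp L) a)
            (isUnit_det_TW (Fp L) a) (JW (Fp L) L a) (JW_eq (Fp L) L a))
          p Φ)
    (hρB : HasThetaMajorants fun
      (p : ↥(UnitaryGroup.adelic (Fp L) L (IsCMField.complexConj L) n (Matrix.diagonal fun i => dD L e dV hdV dW hdW (Fin.natAdd n i))) ×
        ↥(UnitaryGroup.adelic (Fp L) L (IsCMField.complexConj L) 1 (JW (Fp L) L a)))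
      (Φ : piSchwartzBruhat (Fp L) (Fin n₂)) =>
        pairRep (Fp L) L (IsCMField.complexConj L) n 1 eB (Matrix.diagonal fun i => dD L e dV hdV dW hdW (Fin.natAdd n i)) (JW (Fp L) L a)
          (chiSplittingLine L eB (fun i => dD L e dV hdV dW hdW (Fin.natAdd n i)) (fun i => dD_conj L e dV hdV dW hdW (Fin.natAdd n i))
            (fun i => dD_ne_zero L e dV hdV dW hdW hdV0 hdW0 (Fin.natAdd n i))
            (toHeckeCharacter L μ) (isUnitary_toHeckeCharacter L μ)
            ((isOscillatorChar_toHeckeCharacter_iff μ).mpr hμ) (TW (Fp L) a)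
            (isUnit_det_TW (Fp L) a) (JW (Fp L) L a) (JW_eq (Fp L) L a))
          p Φ)
    (g₁ g₂ : UnitaryGroup.adelic (Fp L) L (IsCMField.complexConj L) N (Matrix.diagonal dV))
    (u : UnitaryGroup.adelic (Fp L) L (IsCMField.complexConj L) 1 (JW (Fp L) L a))
    (Φ₁ : piSchwartzBruhat (Fp L) (Fin n₁)) (Φ₂ : piSchwartzBruhat (Fp L) (Fin n₂)) :
    (lineThetaKernelDatum L (n + n) eD (dD L e dV hdV dW hdW) (dD_conj L e dV hdV dW hdW) (dD_ne_zero L e dV hdV dW hdW hdV0 hdW0)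
        μ hμ a hρD).thetaKer (sumTensor (Fp L) (idxSplit eD eA eB) Φ₁ Φ₂)
        (QuotientGroup.mk (toDiagA L e dV hdV dW hdW (iotaV L e dV hdV dW hdW (g₁, g₂)))⁻¹, QuotientGroup.mk u) =
      (lineThetaKernelDatum L n eA (fun i => dD L e dV hdV dW hdW (Fin.castAdd n i)) (fun i => dD_conj L e dV hdV dW hdW (Fin.castAdd n i))
          (fun i => dD_ne_zero L e dV hdV dW hdW hdV0 hdW0 (Fin.castAdd n i)) μ hμ a hρA).thetaKer Φ₁
          (QuotientGroup.mk (⟨_, reindexGL_adelicInl_mem_castAdd L e dV hdV dW hdW g₁⟩ :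
            UnitaryGroup.adelic (Fp L) L (IsCMField.complexConj L) n (Matrix.diagonal fun i => dD L e dV hdV dW hdW (Fin.castAdd n i)))⁻¹,
            QuotientGroup.mk u) *
        (lineThetaKernelDatum L n eB (fun i => dD L e dV hdV dW hdW (Fin.natAdd n i)) (fun i => dD_conj L e dV hdV dW hdW (Fin.natAdd n i))
          (fun i => dD_ne_zero L e dV hdV dW hdW hdV0 hdW0 (Fin.natAdd n i)) μ hμ a hρB).thetaKer Φ₂
          (QuotientGroup.mk (⟨_, reindexGL_adelicInl_mem_natAdd L e dV hdV dW hdW g₂⟩ :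
            UnitaryGroup.adelic (Fp L) L (IsCMField.complexConj L) n (Matrix.diagonal fun i => dD L e dV hdV dW hdW (Fin.natAdd n i)))⁻¹,
            QuotientGroup.mk u) := by
  -- `(toDiagA ι(g₁,g₂))⁻¹ = toDiagA ι(g₁⁻¹, g₂⁻¹)` and `kⱼ(g)⁻¹ = kⱼ(g⁻¹)` (homomorphisms)
  have e0 : (toDiagA L e dV hdV dW hdW (iotaV L e dV hdV dW hdW (g₁, g₂)))⁻¹ = toDiagA L e dV hdV dW hdW (iotaV L e dV hdV dW hdW (g₁⁻¹, g₂⁻¹)) := by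
    rw [← map_inv, ← map_inv, Prod.inv_mk]
  have e1 : (⟨_, reindexGL_adelicInl_mem_castAdd L e dV hdV dW hdW g₁⟩ :
      UnitaryGroup.adelic (Fp L) L (IsCMField.complexConj L) n (Matrix.diagonal fun i => dD L e dV hdV dW hdW (Fin.castAdd n i)))⁻¹ =
      ⟨_, reindexGL_adelicInl_mem_castAdd L e dV hdV dW hdW g₁⁻¹⟩ := by
    refine Subtype.ext ?_
    show (UnitaryGroup.reindexGL e ((UnitaryGroup.adelicInl (Fp L) L (IsCMField.complexConj L) N M (Matrix.diagonal dV) (Matrix.diagonal dW) g₁ :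
        UnitaryGroup.adelicPair (Fp L) L (IsCMField.complexConj L) N M (Matrix.diagonal dV) (Matrix.diagonal dW)) :
          GL (Fin N × Fin M) (AdeleRing (𝓞 L) L)))⁻¹ =
      UnitaryGroup.reindexGL e ((UnitaryGroup.adelicInl (Fp L) L (IsCMField.complexConj L) N M (Matrix.diagonal dV) (Matrix.diagonal dW) g₁⁻¹ :
        UnitaryGroup.adelicPair (Fp L) L (IsCMField.complexConj L) N M (Matrix.diagonal dV) (Matrix.diagonal dW)) :
          GL (Fin N × Fin M) (AdeleRing (𝓞 L) L))
    rw [map_inv, Subgroup.coe_inv, map_inv]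
  have e2 : (⟨_, reindexGL_adelicInl_mem_natAdd L e dV hdV dW hdW g₂⟩ :
      UnitaryGroup.adelic (Fp L) L (IsCMField.complexConj L) n (Matrix.diagonal fun i => dD L e dV hdV dW hdW (Fin.natAdd n i)))⁻¹ =
      ⟨_, reindexGL_adelicInl_mem_natAdd L e dV hdV dW hdW g₂⁻¹⟩ := by
    refine Subtype.ext ?_
    show (UnitaryGroup.reindexGL e ((UnitaryGroup.adelicInl (Fp L) L (IsCMField.complexConj L) N M (Matrix.diagonal dV) (Matrix.diagonal dW) g₂ :
        UnitaryGroup.adelicPair (Fp L) L (IsCMField.complexConj L) N M (Matrix.diagonal dV) (Matrix.diagonal dW)) :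
          GL (Fin N × Fin M) (AdeleRing (𝓞 L) L)))⁻¹ =
      UnitaryGroup.reindexGL e ((UnitaryGroup.adelicInl (Fp L) L (IsCMField.complexConj L) N M (Matrix.diagonal dV) (Matrix.diagonal dW) g₂⁻¹ :
        UnitaryGroup.adelicPair (Fp L) L (IsCMField.complexConj L) N M (Matrix.diagonal dV) (Matrix.diagonal dW)) :
          GL (Fin N × Fin M) (AdeleRing (𝓞 L) L))
    rw [map_inv, Subgroup.coe_inv, map_inv]
  rw [e0, e1, e2]
  exact lineThetaKer_dD_blockDiag L e dV hdV hdV0 dW hdW hdW0 eD eA eB μ hμ a hρD hρA hρB _ _ _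
    (coe_toDiagA_iotaV L e dV hdV dW hdW g₁⁻¹ g₂⁻¹) u Φ₁ Φ₂

end Summit.HodgeConjecture.HodgeConjecture.Cruxes.HLiu418.K2LiuDoubledKernelAtIota

end
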